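import Mathlib

/-!
# An elementary Szemerédi–Trotter bound on Cartesian products (grid cutting)

Helper for route `NewtonFrames`, crux `NewtonTauWeak` (stmt-ValiantsHypothesis-5904), line «low-parallelism»
(`Cruxes/NewtonTauWeak/Lines/low_parallelism.lean`): the `θ = 0` endpoint of the registered law `LowParallelismLawAt θ C`
(an `n × n` Cartesian product against `≤ n²` non-vertical lines has `O(n^{8/3})` incidences) is Szemerédi–Trotter in the
Erdős-extremal regime.  Proved here WITHOUT crossing lemma / polynomial partitioning, by the cutting special to products:
lines are coded `(s, c) : ℝ × ℝ` (`y = s·x + c`), incidences are `((A ×ˢ B) ×ˢ M).filter (q ↦ q.1.2 = q.2.1 * q.1.1 + q.2.2)`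
(the coding of the workfile's `incTriples` and of `Literature.Combinatorics.Additive.inc`); two points determine a line, so
Cauchy–Schwarz gives `I(P, M) ≤ |M| + |P|·√|M|` (`inc_le_card_add_mul_sqrt`); cutting `A`, `B` into `r` ORDER blocks of
`≤ q` elements, the `r²` cells partition `A ×ˢ B`, each has `≤ q²` points, and a non-vertical line meets `≤ 2r` cells (the
cells of its points form a chain for the product order, `card_touched_le`); summing with Cauchy–Schwarz over the cells,
`I(A ×ˢ B, M) ≤ 2r|M| + q²·√(2r³|M|)` (`inc_prod_le_cells`) and, with `r = m²`, `q = m`, `m = ⌈(n+2)^{1/3}⌉`,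
`I ≤ 72·(n+2)^{8/3}` for `|A|, |B| ≤ n`, `|M| ≤ n²` (`card_incidences_le_rpow`).  The product cutting is folklore; the
general theorem is Szemerédi–Trotter (1983).  The two final statements use Mathlib constants only.
-/

set_option linter.dupNamespace false

namespace Summit.ValiantsHypothesis.ValiantsHypothesis.Theorems.NewtonFramesNewtonTauWeak.CartesianIncidence

open Finset

noncomputable section

/-- Two distinct points lie on at most one non-vertical line. -/
theorem line_eq_of_two_points {p p' l l' : ℝ × ℝ} (hne : p ≠ p')
    (h1 : p.2 = l.1 * p.1 + l.2) (h2 : p'.2 = l.1 * p'.1 + l.2)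
    (h1' : p.2 = l'.1 * p.1 + l'.2) (h2' : p'.2 = l'.1 * p'.1 + l'.2) : l = l' := by
  have hx : p.1 ≠ p'.1 := by
    intro hx
    apply hne
    refine Prod.ext hx ?_
    rw [h1, h2, hx]
  have hs : l.1 = l'.1 := by
    have hprod : (l.1 - l'.1) * (p.1 - p'.1) = 0 := by linear_combination -h1 + h2 + h1' - h2'
    rcases mul_eq_zero.1 hprod with h | h
    · exact sub_eq_zero.1 h
    · exact absurd (sub_eq_zero.1 h) hx
  refine Prod.ext hs ?_
  rw [hs] at h1
  linarith

/-- The incidence count is the sum over the lines of the per-line point counts. -/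
theorem inc_eq_sum_lines (P M : Finset (ℝ × ℝ)) :
    ((P ×ˢ M).filter fun z : (ℝ × ℝ) × (ℝ × ℝ) => z.1.2 = z.2.1 * z.1.1 + z.2.2).card
      = ∑ l ∈ M, (P.filter fun p : ℝ × ℝ => p.2 = l.1 * p.1 + l.2).card := by
  rw [card_filter, sum_product_right]
  refine sum_congr rfl fun l _ => ?_
  rw [card_filter]

/-- The incidence count is the sum over the points of the per-point line counts. -/
theorem inc_eq_sum_points (P M : Finset (ℝ × ℝ)) :
    ((P ×ˢ M).filter fun z : (ℝ × ℝ) × (ℝ × ℝ) => z.1.2 = z.2.1 * z.1.1 + z.2.2).card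
      = ∑ p ∈ P, (M.filter fun l : ℝ × ℝ => p.2 = l.1 * p.1 + l.2).card := by
  rw [card_filter, sum_product]
  refine sum_congr rfl fun p _ => ?_
  rw [card_filter]

/-- Ordered pairs of distinct points on a common line of `M`, summed over the lines, number at most `|P|² - |P|`
(two points determine the line). -/
theorem sum_offDiag_card_le (P M : Finset (ℝ × ℝ)) :
    ∑ l ∈ M, ((P.filter fun p : ℝ × ℝ => p.2 = l.1 * p.1 + l.2).offDiag).card ≤ P.card * P.card - P.card := by
  rw [← offDiag_card, ← card_biUnion]
  · refine card_le_card fun pp hpp => ?_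
    simp only [mem_biUnion, mem_offDiag, mem_filter] at hpp ⊢
    obtain ⟨l, -, ⟨hp, -⟩, ⟨hp', -⟩, hne⟩ := hpp
    exact ⟨hp, hp', hne⟩
  · intro l _ l' _ hll'
    simp only [Function.onFun]
    rw [disjoint_left]
    intro pp h h'
    simp only [mem_offDiag, mem_filter] at h h'
    exact hll' (line_eq_of_two_points h.2.2 h.1.2 h.2.1.2 h'.1.2 h'.2.1.2)

/-- **`K₂,₂`-free Cauchy–Schwarz**: `I(P, M) ≤ |M| + |P|·√|M|` for any finite point set `P` and any finite set `M`
of non-vertical lines. -/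
theorem inc_le_card_add_mul_sqrt (P M : Finset (ℝ × ℝ)) :
    ((((P ×ˢ M).filter fun z : (ℝ × ℝ) × (ℝ × ℝ) => z.1.2 = z.2.1 * z.1.1 + z.2.2).card : ℕ) : ℝ)
      ≤ M.card + P.card * Real.sqrt M.card := by
  set I := ((P ×ˢ M).filter fun z : (ℝ × ℝ) × (ℝ × ℝ) => z.1.2 = z.2.1 * z.1.1 + z.2.2).card with hI
  set k : ℝ × ℝ → ℕ := fun l => (P.filter fun p : ℝ × ℝ => p.2 = l.1 * p.1 + l.2).card with hk
  have hsum : I = ∑ l ∈ M, k l := inc_eq_sum_lines P M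
  have hpairs : ∑ l ∈ M, (k l * k l - k l) ≤ P.card * P.card - P.card := by
    have h := sum_offDiag_card_le P M
    simpa only [offDiag_card] using h
  have hsq : ∑ l ∈ M, k l * k l ≤ P.card * P.card + I := by
    have hsplit : ∑ l ∈ M, k l * k l = ∑ l ∈ M, (k l * k l - k l) + ∑ l ∈ M, k l := by
      rw [← sum_add_distrib]
      refine sum_congr rfl fun l _ => ?_
      exact (Nat.sub_add_cancel (Nat.le_mul_self _)).symm
    rw [hsplit, ← hsum]
    calc ∑ l ∈ M, (k l * k l - k l) + I ≤ (P.card * P.card - P.card) + I := Nat.add_le_add_right hpairs _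
      _ ≤ P.card * P.card + I := Nat.add_le_add_right (Nat.sub_le _ _) _
  have hcs : I * I ≤ M.card * (P.card * P.card + I) := by
    have h1 : (∑ l ∈ M, k l) ^ 2 ≤ M.card * ∑ l ∈ M, k l ^ 2 := sq_sum_le_card_mul_sum_sq
    rw [← hsum] at h1
    calc I * I = I ^ 2 := (sq I).symm
      _ ≤ M.card * ∑ l ∈ M, k l ^ 2 := h1
      _ ≤ M.card * (P.card * P.card + I) := by
          refine Nat.mul_le_mul_left _ ?_
          simpa only [sq] using hsq
  have hR : (I : ℝ) * I ≤ (M.card : ℝ) * ((P.card : ℝ) * P.card + I) := by exact_mod_cast hcs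
  have hm : (0 : ℝ) ≤ M.card := Nat.cast_nonneg _
  have hp : (0 : ℝ) ≤ P.card := Nat.cast_nonneg _
  have hs0 : 0 ≤ Real.sqrt M.card := Real.sqrt_nonneg _
  have hs2 : Real.sqrt (M.card : ℝ) ^ 2 = M.card := Real.sq_sqrt hm
  by_contra h
  have h' : (M.card : ℝ) + P.card * Real.sqrt M.card < I := lt_of_not_ge h
  have h1 : 0 < (I : ℝ) - (M.card + P.card * Real.sqrt M.card) := sub_pos.2 h'
  have hxpos : (0 : ℝ) < I := lt_of_le_of_lt (by positivity) h'
  nlinarith [mul_pos h1 hxpos, mul_nonneg (mul_nonneg hp hs0) h1.le,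
    mul_nonneg (mul_nonneg hp hs0) hm, hs2]

/-- The rank `#{x ∈ A : x < a}` is monotone in `a`. -/
theorem rank_mono (A : Finset ℝ) {a a' : ℝ} (h : a ≤ a') : (A.filter fun x => x < a).card ≤ (A.filter fun x => x < a').card :=
  card_le_card fun x hx => by
    simp only [mem_filter] at hx ⊢
    exact ⟨hx.1, lt_of_lt_of_le hx.2 h⟩
/-- The rank is strictly monotone on `A`. -/
theorem rank_lt_rank (A : Finset ℝ) {a a' : ℝ} (ha : a ∈ A) (h : a < a') : (A.filter fun x => x < a).card < (A.filter fun x => x < a').card := by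
  refine card_lt_card ⟨fun x hx => ?_, fun hsub => ?_⟩
  · simp only [mem_filter] at hx ⊢
    exact ⟨hx.1, hx.2.trans h⟩
  · have hmem : a ∈ A.filter fun x => x < a := hsub (by simp [ha, h])
    simp at hmem
/-- Ranks of members are `< |A|`. -/
theorem rank_lt_card (A : Finset ℝ) {a : ℝ} (ha : a ∈ A) : (A.filter fun x => x < a).card < A.card := by
  refine card_lt_card ⟨filter_subset _ _, fun hsub => ?_⟩
  have hmem : a ∈ A.filter fun x => x < a := hsub ha
  simp at hmem
/-- Block indices `rank / q` are monotone. -/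
theorem blk_mono (A : Finset ℝ) (q : ℕ) {a a' : ℝ} (h : a ≤ a') : (A.filter fun x => x < a).card / q ≤ (A.filter fun x => x < a').card / q :=
  Nat.div_le_div_right (rank_mono A h)
/-- With `|A| ≤ r·q` every member lies in one of the first `r` blocks. -/
theorem blk_lt (A : Finset ℝ) {q r : ℕ} (hA : A.card ≤ r * q) {a : ℝ} (ha : a ∈ A) : (A.filter fun x => x < a).card / q < r := by
  rcases Nat.eq_zero_or_pos q with hq | hq
  · subst hq
    have h := card_pos.2 ⟨a, ha⟩
    rw [mul_zero] at hA
    omega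
  · exact (Nat.div_lt_iff_lt_mul hq).2 ((rank_lt_card A ha).trans_le hA)

/-- Each block has at most `q` elements. -/
theorem card_blk_le (A : Finset ℝ) {q : ℕ} (hq : 0 < q) (i : ℕ) :
    (A.filter fun a => (A.filter fun x => x < a).card / q = i).card ≤ q := by
  calc (A.filter fun a => (A.filter fun x => x < a).card / q = i).card ≤ (Finset.Ico (i * q) (i * q + q)).card := by
        refine card_le_card_of_injOn (fun a => (A.filter fun x => x < a).card) (fun a ha => ?_) ?_
        · obtain ⟨-, hi⟩ := mem_filter.1 (mem_coe.1 ha)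
          subst hi
          rw [mem_coe, mem_Ico]
          refine ⟨Nat.div_mul_le_self _ _, ?_⟩
          have h := Nat.lt_div_mul_add (a := (A.filter fun x => x < a).card) hq
          linarith
        · intro a ha a' ha' h
          have hA : a ∈ A := (mem_filter.1 (mem_coe.1 ha)).1
          have hA' : a' ∈ A := (mem_filter.1 (mem_coe.1 ha')).1
          by_contra hne
          rcases lt_or_gt_of_ne hne with hlt | hlt
          · exact absurd h (ne_of_lt (rank_lt_rank A hA hlt))
          · exact absurd h (ne_of_gt (rank_lt_rank A hA' hlt))
    _ = q := by simp
/-- A chain for the product order inside `r × r` has at most `2r` cells. -/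
theorem card_chain_le {r : ℕ} (T : Finset (ℕ × ℕ)) (hT : T ⊆ range r ×ˢ range r)
    (hch : ∀ c ∈ T, ∀ c' ∈ T, (c.1 ≤ c'.1 ∧ c.2 ≤ c'.2) ∨ (c'.1 ≤ c.1 ∧ c'.2 ≤ c.2)) :
    T.card ≤ 2 * r := by
  calc T.card ≤ (range (2 * r)).card := by
        refine card_le_card_of_injOn (fun c => c.1 + c.2) (fun c hc => ?_) ?_
        · have h := hT (mem_coe.1 hc)
          simp only [mem_product, mem_range] at h
          simp only [mem_coe, mem_range]
          omega
        · intro c hc c' hc' h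
          have h1 := hch c (mem_coe.1 hc) c' (mem_coe.1 hc')
          simp only at h
          rcases h1 with h' | h' <;> exact Prod.ext (by omega) (by omega)
    _ = 2 * r := card_range _
/-- A chain for the order `(≤, ≥)` inside `r × r` has at most `2r` cells. -/
theorem card_antichain_le {r : ℕ} (T : Finset (ℕ × ℕ)) (hT : T ⊆ range r ×ˢ range r)
    (hch : ∀ c ∈ T, ∀ c' ∈ T, (c.1 ≤ c'.1 ∧ c'.2 ≤ c.2) ∨ (c'.1 ≤ c.1 ∧ c.2 ≤ c'.2)) :
    T.card ≤ 2 * r := by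
  calc T.card ≤ (range (2 * r)).card := by
        refine card_le_card_of_injOn (fun c => c.1 + (r - 1 - c.2)) (fun c hc => ?_) ?_
        · have h := hT (mem_coe.1 hc)
          simp only [mem_product, mem_range] at h
          simp only [mem_coe, mem_range]
          omega
        · intro c hc c' hc' h
          have h1 := hch c (mem_coe.1 hc) c' (mem_coe.1 hc')
          have h2 := hT (mem_coe.1 hc)
          have h3 := hT (mem_coe.1 hc')
          simp only [mem_product, mem_range] at h2 h3
          simp only at h
          rcases h1 with h' | h' <;> exact Prod.ext (by omega) (by omega)
    _ = 2 * r := card_range _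

/-- The cells `(rank_A x / q, rank_B y / q)` visited by the points of `A ×ˢ B` on one non-vertical line number `≤ 2r`. -/
theorem card_touched_le (A B : Finset ℝ) (q r : ℕ) (l : ℝ × ℝ) :
    ((range r ×ˢ range r).filter fun c : ℕ × ℕ =>
        ∃ p ∈ A ×ˢ B, ((A.filter fun x => x < p.1).card / q, (B.filter fun x => x < p.2).card / q) = c ∧ p.2 = l.1 * p.1 + l.2).card ≤ 2 * r := by
  have hsub : ((range r ×ˢ range r).filter fun c : ℕ × ℕ =>
      ∃ p ∈ A ×ˢ B, ((A.filter fun x => x < p.1).card / q, (B.filter fun x => x < p.2).card / q) = c ∧ p.2 = l.1 * p.1 + l.2) ⊆ range r ×ˢ range r :=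
    filter_subset _ _
  rcases le_or_gt 0 l.1 with hs | hs
  · refine card_chain_le _ hsub ?_
    intro c hc c' hc'
    obtain ⟨-, p, -, hpc, hpl⟩ := mem_filter.1 hc
    obtain ⟨-, p', -, hpc', hpl'⟩ := mem_filter.1 hc'
    rw [← hpc, ← hpc']
    rcases le_total p.1 p'.1 with h | h
    · left
      have h2 : p.2 ≤ p'.2 := by rw [hpl, hpl']; nlinarith [mul_le_mul_of_nonneg_left h hs]
      exact ⟨blk_mono A q h, blk_mono B q h2⟩
    · right
      have h2 : p'.2 ≤ p.2 := by rw [hpl, hpl']; nlinarith [mul_le_mul_of_nonneg_left h hs]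
      exact ⟨blk_mono A q h, blk_mono B q h2⟩
  · refine card_antichain_le _ hsub ?_
    intro c hc c' hc'
    obtain ⟨-, p, -, hpc, hpl⟩ := mem_filter.1 hc
    obtain ⟨-, p', -, hpc', hpl'⟩ := mem_filter.1 hc'
    rw [← hpc, ← hpc']
    rcases le_total p.1 p'.1 with h | h
    · left
      have h2 : p'.2 ≤ p.2 := by rw [hpl, hpl']; nlinarith [mul_le_mul_of_nonpos_left h hs.le]
      exact ⟨blk_mono A q h, blk_mono B q h2⟩
    · right
      have h2 : p.2 ≤ p'.2 := by rw [hpl, hpl']; nlinarith [mul_le_mul_of_nonpos_left h hs.le]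
      exact ⟨blk_mono A q h, blk_mono B q h2⟩

/-- **Cell bound.** If `|A|, |B| ≤ r·q` then `I(A ×ˢ B, M) ≤ 2r·|M| + q²·√(2 r³ |M|)` for every finite set `M` of
non-vertical lines. -/
theorem inc_prod_le_cells (r q : ℕ) (A B : Finset ℝ) (M : Finset (ℝ × ℝ))
    (hA : A.card ≤ r * q) (hB : B.card ≤ r * q) :
    ((((A ×ˢ B) ×ˢ M).filter fun z : (ℝ × ℝ) × (ℝ × ℝ) => z.1.2 = z.2.1 * z.1.1 + z.2.2).card : ℝ)
      ≤ 2 * r * M.card + (q : ℝ) ^ 2 * Real.sqrt (2 * (r : ℝ) ^ 3 * M.card) := by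
  rcases Nat.eq_zero_or_pos q with hq | hq
  · subst hq
    rw [mul_zero, Nat.le_zero, card_eq_zero] at hA
    subst hA
    simp only [empty_product, filter_empty, card_empty, Nat.cast_zero]
    positivity
  set P := A ×ˢ B with hP
  set cell : ℝ × ℝ → ℕ × ℕ := fun p => ((A.filter fun x => x < p.1).card / q, (B.filter fun x => x < p.2).card / q) with hcell
  set cells := range r ×ˢ range r with hcells
  set on : (ℝ × ℝ) → (ℝ × ℝ) → Prop := fun p l => p.2 = l.1 * p.1 + l.2 with hon
  set Pc : ℕ × ℕ → Finset (ℝ × ℝ) := fun c => P.filter fun p => cell p = c with hPc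
  set Mc : ℕ × ℕ → Finset (ℝ × ℝ) := fun c => M.filter fun l => ∃ p ∈ P, cell p = c ∧ on p l with hMc
  have hmaps : ∀ p ∈ P, cell p ∈ cells := by
    intro p hp
    obtain ⟨ha, hb⟩ := mem_product.1 hp
    exact mem_product.2 ⟨mem_range.2 (blk_lt A hA ha), mem_range.2 (blk_lt B hB hb)⟩
  -- (a) incidences split over the cells
  have hsplit : ((P ×ˢ M).filter fun z : (ℝ × ℝ) × (ℝ × ℝ) => on z.1 z.2).card
      = ∑ c ∈ cells, (((Pc c) ×ˢ M).filter fun z : (ℝ × ℝ) × (ℝ × ℝ) => on z.1 z.2).card := by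
    rw [inc_eq_sum_points, ← sum_fiberwise_of_maps_to hmaps]
    refine sum_congr rfl fun c _ => ?_
    rw [inc_eq_sum_points]
  -- (b) in a cell only the touching lines matter
  have hrestrict : ∀ c, (((Pc c) ×ˢ M).filter fun z : (ℝ × ℝ) × (ℝ × ℝ) => on z.1 z.2)
      = (((Pc c) ×ˢ Mc c).filter fun z : (ℝ × ℝ) × (ℝ × ℝ) => on z.1 z.2) := by
    intro c
    ext z
    simp only [mem_filter, mem_product, hPc, hMc]
    constructor
    · rintro ⟨⟨⟨hzP, hzc⟩, hzM⟩, hz⟩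
      exact ⟨⟨⟨hzP, hzc⟩, hzM, z.1, hzP, hzc, hz⟩, hz⟩
    · rintro ⟨⟨hzP, hzM, -⟩, hz⟩
      exact ⟨⟨hzP, hzM⟩, hz⟩
  -- (c) points per cell
  have hPc_card : ∀ c, ((Pc c).card : ℝ) ≤ (q : ℝ) ^ 2 := by
    intro c
    have h1 : Pc c ⊆ (A.filter fun a => (A.filter fun x => x < a).card / q = c.1) ×ˢ (B.filter fun b => (B.filter fun x => x < b).card / q = c.2) := by
      intro p hp
      simp only [hPc, mem_filter, hP, mem_product, hcell, Prod.ext_iff] at hp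
      exact mem_product.2 ⟨mem_filter.2 ⟨hp.1.1, hp.2.1⟩, mem_filter.2 ⟨hp.1.2, hp.2.2⟩⟩
    have h2 : (Pc c).card ≤ q * q :=
      (card_le_card h1).trans ((card_product _ _).le.trans
        (Nat.mul_le_mul (card_blk_le A hq _) (card_blk_le B hq _)))
    have h3 : ((Pc c).card : ℝ) ≤ (q : ℝ) * q := by exact_mod_cast h2
    simpa [sq] using h3
  -- (d) total number of (cell, touching line) pairs
  have htouch : (∑ c ∈ cells, ((Mc c).card : ℝ)) ≤ 2 * r * M.card := by
    have h1 : ∑ c ∈ cells, (Mc c).card = ∑ l ∈ M, (cells.filter fun c => ∃ p ∈ P, cell p = c ∧ on p l).card := by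
      simp only [hMc, card_filter]
      exact sum_comm
    have h2 : ∀ l ∈ M, (cells.filter fun c => ∃ p ∈ P, cell p = c ∧ on p l).card ≤ 2 * r :=
      fun l _ => card_touched_le A B q r l
    have h3 : ∑ c ∈ cells, (Mc c).card ≤ 2 * r * M.card := by
      rw [h1]
      calc ∑ l ∈ M, (cells.filter fun c => ∃ p ∈ P, cell p = c ∧ on p l).card
          ≤ ∑ _l ∈ M, 2 * r := sum_le_sum h2
        _ = 2 * r * M.card := by rw [sum_const, smul_eq_mul]; ring
    exact_mod_cast h3
  -- (e) Cauchy–Schwarz over the cells for the square roots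
  have hsqrt : (∑ c ∈ cells, Real.sqrt ((Mc c).card : ℝ)) ≤ Real.sqrt (2 * (r : ℝ) ^ 3 * M.card) := by
    have h1 : (∑ c ∈ cells, Real.sqrt ((Mc c).card : ℝ)) ^ 2
        ≤ cells.card * ∑ c ∈ cells, Real.sqrt ((Mc c).card : ℝ) ^ 2 := sq_sum_le_card_mul_sum_sq
    have h2 : ∑ c ∈ cells, Real.sqrt ((Mc c).card : ℝ) ^ 2 = ∑ c ∈ cells, ((Mc c).card : ℝ) :=
      sum_congr rfl fun c _ => Real.sq_sqrt (Nat.cast_nonneg _)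
    have hcells_card : (cells.card : ℝ) = (r : ℝ) ^ 2 := by
      simp only [hcells, card_product, card_range, Nat.cast_mul, sq]
    rw [h2, hcells_card] at h1
    have h3 : (∑ c ∈ cells, Real.sqrt ((Mc c).card : ℝ)) ^ 2 ≤ 2 * (r : ℝ) ^ 3 * M.card := by
      calc _ ≤ (r : ℝ) ^ 2 * ∑ c ∈ cells, ((Mc c).card : ℝ) := h1
        _ ≤ (r : ℝ) ^ 2 * (2 * r * M.card) := by gcongr
        _ = 2 * (r : ℝ) ^ 3 * M.card := by ring
    have h4 : 0 ≤ ∑ c ∈ cells, Real.sqrt ((Mc c).card : ℝ) := sum_nonneg fun c _ => Real.sqrt_nonneg _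
    calc ∑ c ∈ cells, Real.sqrt ((Mc c).card : ℝ) = Real.sqrt ((∑ c ∈ cells, Real.sqrt ((Mc c).card : ℝ)) ^ 2) :=
          (Real.sqrt_sq h4).symm
      _ ≤ Real.sqrt (2 * (r : ℝ) ^ 3 * M.card) := Real.sqrt_le_sqrt h3
  -- (f) assemble
  have hcellbound : ∀ c ∈ cells, ((((Pc c) ×ˢ M).filter fun z : (ℝ × ℝ) × (ℝ × ℝ) => on z.1 z.2).card : ℝ)
      ≤ (Mc c).card + (q : ℝ) ^ 2 * Real.sqrt ((Mc c).card : ℝ) := by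
    intro c _
    rw [hrestrict c]
    calc ((((Pc c) ×ˢ Mc c).filter fun z : (ℝ × ℝ) × (ℝ × ℝ) => on z.1 z.2).card : ℝ)
        ≤ (Mc c).card + (Pc c).card * Real.sqrt ((Mc c).card : ℝ) := inc_le_card_add_mul_sqrt (Pc c) (Mc c)
      _ ≤ (Mc c).card + (q : ℝ) ^ 2 * Real.sqrt ((Mc c).card : ℝ) := by
          gcongr
          exact hPc_card c
  calc ((((A ×ˢ B) ×ˢ M).filter fun z : (ℝ × ℝ) × (ℝ × ℝ) => z.1.2 = z.2.1 * z.1.1 + z.2.2).card : ℝ)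
      = ∑ c ∈ cells, ((((Pc c) ×ˢ M).filter fun z : (ℝ × ℝ) × (ℝ × ℝ) => on z.1 z.2).card : ℝ) := by
        rw [← hP]; exact_mod_cast hsplit
    _ ≤ ∑ c ∈ cells, (((Mc c).card : ℝ) + (q : ℝ) ^ 2 * Real.sqrt ((Mc c).card : ℝ)) := sum_le_sum hcellbound
    _ = (∑ c ∈ cells, ((Mc c).card : ℝ)) + (q : ℝ) ^ 2 * ∑ c ∈ cells, Real.sqrt ((Mc c).card : ℝ) := by
        rw [sum_add_distrib, mul_sum]
    _ ≤ 2 * r * M.card + (q : ℝ) ^ 2 * Real.sqrt (2 * (r : ℝ) ^ 3 * M.card) := by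
        gcongr

/-- **Szemerédi–Trotter for Cartesian products (Erdős-extremal regime), elementary.**  There is an absolute
constant `C` (here `72`) such that for all `n`, all `A, B ⊂ ℝ` with `|A|, |B| ≤ n` and every set `M` of `≤ n²`
non-vertical lines, the number of incidences of `A ×ˢ B` with `M` is at most `C·(n+2)^{8/3}`.  This is the
`θ = 0` case of the line's `LowParallelismLawAt θ C` (no parallelism hypothesis needed). -/
theorem card_incidences_le_rpow : ∃ C : ℝ, 0 < C ∧ ∀ (n : ℕ) (A B : Finset ℝ) (M : Finset (ℝ × ℝ)),
    A.card ≤ n → B.card ≤ n → M.card ≤ n ^ 2 →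
      ((((A ×ˢ B) ×ˢ M).filter fun q : (ℝ × ℝ) × (ℝ × ℝ) => q.1.2 = q.2.1 * q.1.1 + q.2.2).card : ℝ)
        ≤ C * ((n : ℝ) + 2) ^ ((8 : ℝ) / 3) := by
  refine ⟨72, by norm_num, ?_⟩
  intro n A B M hA hB hM
  set x : ℝ := (n : ℝ) + 2 with hx
  have hx1 : (1 : ℝ) ≤ x := by rw [hx]; linarith [(Nat.cast_nonneg n : (0 : ℝ) ≤ n)]
  have hx0 : (0 : ℝ) ≤ x := by linarith
  set t : ℝ := x ^ ((1 : ℝ) / 3) with ht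
  have ht0 : 0 ≤ t := Real.rpow_nonneg hx0 _
  have ht1 : 1 ≤ t := Real.one_le_rpow hx1 (by norm_num)
  have ht3 : t ^ 3 = x := by
    rw [ht, ← Real.rpow_natCast, ← Real.rpow_mul hx0]; norm_num
  have h83 : x ^ ((8 : ℝ) / 3) = t ^ 8 := by
    rw [ht, ← Real.rpow_natCast, ← Real.rpow_mul hx0]; norm_num
  set m : ℕ := ⌈t⌉₊ with hm
  have hmt : t ≤ m := Nat.le_ceil t
  have hm2 : (m : ℝ) ≤ 2 * t := by
    have h := Nat.ceil_lt_add_one ht0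
    rw [← hm] at h
    linarith
  have hnm : n ≤ m ^ 2 * m := by
    have h1 : (n : ℝ) ≤ x := by rw [hx]; linarith
    have h2 : x ≤ (m : ℝ) ^ 3 := by rw [← ht3]; exact pow_le_pow_left₀ ht0 hmt 3
    have h3 : (n : ℝ) ≤ ((m ^ 2 * m : ℕ) : ℝ) := by push_cast; nlinarith
    exact_mod_cast h3
  have hcells := inc_prod_le_cells (m ^ 2) m A B M (hA.trans hnm) (hB.trans hnm)
  have hMn : (M.card : ℝ) ≤ (n : ℝ) ^ 2 := by exact_mod_cast hM
  have hn0 : (0 : ℝ) ≤ n := Nat.cast_nonneg n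
  have hnx : (n : ℝ) ≤ t ^ 3 := by rw [ht3, hx]; linarith
  have hsq : Real.sqrt (2 * ((m ^ 2 : ℕ) : ℝ) ^ 3 * M.card) ≤ (m : ℝ) ^ 3 * (2 * n) := by
    rw [Real.sqrt_le_left (by positivity)]
    push_cast
    have : (0 : ℝ) ≤ (m : ℝ) := Nat.cast_nonneg m
    nlinarith [pow_nonneg this 6, hMn]
  have hm0 : (0 : ℝ) ≤ (m : ℝ) := Nat.cast_nonneg m
  have hmpow2 : (m : ℝ) ^ 2 ≤ (2 * t) ^ 2 := pow_le_pow_left₀ hm0 hm2 2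
  have hmpow5 : (m : ℝ) ^ 5 ≤ (2 * t) ^ 5 := pow_le_pow_left₀ hm0 hm2 5
  calc ((((A ×ˢ B) ×ˢ M).filter fun q : (ℝ × ℝ) × (ℝ × ℝ) => q.1.2 = q.2.1 * q.1.1 + q.2.2).card : ℝ)
      ≤ 2 * ((m ^ 2 : ℕ) : ℝ) * M.card + ((m : ℕ) : ℝ) ^ 2 * Real.sqrt (2 * ((m ^ 2 : ℕ) : ℝ) ^ 3 * M.card) := hcells
    _ ≤ 2 * (m : ℝ) ^ 2 * (n : ℝ) ^ 2 + (m : ℝ) ^ 2 * ((m : ℝ) ^ 3 * (2 * n)) := by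
        push_cast
        gcongr
        · exact_mod_cast hsq
    _ = 2 * (m : ℝ) ^ 2 * (n : ℝ) ^ 2 + 2 * (m : ℝ) ^ 5 * n := by ring
    _ ≤ 2 * (2 * t) ^ 2 * (t ^ 3) ^ 2 + 2 * (2 * t) ^ 5 * t ^ 3 := by
        gcongr
    _ = 72 * t ^ 8 := by ring
    _ = 72 * ((n : ℝ) + 2) ^ ((8 : ℝ) / 3) := by rw [← hx, h83]

end

end Summit.ValiantsHypothesis.ValiantsHypothesis.Theorems.NewtonFramesNewtonTauWeak.CartesianIncidence
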